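import Literature.AlgebraicTopology.CharacteristicClasses.ProjectiveHyperplaneCover
import Mathlib.Analysis.Convex.Contractible
import HarnessLib

/-!
# Cells of the punctured affine chart of `ℙ(V)`: the hemispherical decomposition in coordinates

Topic `Literature/AlgebraicTopology/CharacteristicClasses`. A. Hatcher, *Algebraic Topology*
(2002), Example 2.? / §3.1 p. 204 (the inductive computation of `H*(Sⁿ)` from the cover by two
open hemispheres meeting in a neighbourhood of the equator `Sⁿ⁻¹`) and Ch. 0 p. 7 / Example 0.6
(the open cell `U_ψ ≅ ℂⁿ⁻¹` of `ℂPⁿ⁻¹` and its centre); D. Husemoller, *Fibre Bundles*, 3rd ed.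
(1994), Ch. 17 §2 (2.3) (the fibre `ℂPⁿ⁻¹` of the projective bundle).

For the Leray–Hirsch argument over a projective bundle one needs the "sphere" `U_ψ ∖ {[u]}` of the
fibre, i.e. the punctured affine chart `≅ ker ψ ∖ 0 ≅ ℝᴹ ∖ 0` (`ProjectiveHyperplaneCover`), cut
into pieces on which the cohomology is known, WITH PARAMETERS. This file is the point-set part:

* in `ℝᴹ = Fin M → ℝ` the open sets `Z N = {∃ i ≤ N, wᵢ ≠ 0}` (so `Z (M-1) = ℝᴹ ∖ 0`,
  `SphereSets.Z_pred_eq`), the half-spaces `Hp N = {w_N > 0}`, `Hm N = {w_N < 0}` and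
  `Zp N = Z N ∪ Hp (N+1)`, `Zm N = Z N ∪ Hm (N+1)` with **`Zp N ∩ Zm N = Z N`,
  `Zp N ∪ Zm N = Z (N+1)`, `Z 0 = Hp 0 ⊔ Hm 0`** and `Zp N`, `Zm N`, `Hp N`, `Hm N` STAR-CONVEX
  (about `±e_{N+1}`, `±e_N`), all open;
* on `ℙ ℂ V` (functional `ψ`, vector `u`, `ψ u = 1`, real coordinates
  `e : ker ψ ≃L[ℝ] ℝᴹ`): the coordinate map `coordMap [v] = e(P(v/ψ v))` (`P = 𝟙 - ψ ⊗ u` the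
  projection onto `ker ψ`), the pieces `pieceSet Zs = U_ψ ∩ coordMap⁻¹ Zs` (open for `Zs` open),
  the homeomorphism `pieceSet Zs ≃ₜ Zs` (`pieceHomeomorph`, through `U_ψ ≃ₜ {ψ = 1} ≃ₜ ker ψ ≃ₜ ℝᴹ`),
  hence **`pieceSet Zs` is contractible for `Zs` star-convex**, and
  **`pieceSet (ℝᴹ ∖ 0) = U_ψ ∩ projChart P`** (the punctured chart), `pieceSet ℝᴹ = U_ψ`.

Everything is proved; no named facts.

## References

* [HatcherAT2002] A. Hatcher, *Algebraic Topology*, CUP 2002, §3.1 p. 204; Ch. 0 p. 7, Example 0.6.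
* [HusemollerFibreBundles1994] D. Husemoller, *Fibre Bundles*, 3rd ed. (1994), Ch. 17 §2 (2.3).
-/

noncomputable section

open Function Set Module
open scoped LinearAlgebra.Projectivization

namespace Literature.AlgebraicTopology.CharacteristicClasses

/-! ### Cells and half-spaces in `ℝᴹ` -/

namespace SphereSets

variable {M : ℕ}

/-- `Z N = {w | ∃ i ≤ N, wᵢ ≠ 0}` — the complement of the coordinate subspace `{w₀ = … = w_N = 0}`
(`≃ ℝᴹ⁻ᴺ⁻¹ × (ℝᴺ⁺¹ ∖ 0) ≃ Sᴺ`). [cite: HatcherAT2002, §3.1 p. 204] -/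
def Z (N : ℕ) : Set (Fin M → ℝ) := {w | ∃ i : Fin M, (i : ℕ) ≤ N ∧ w i ≠ 0}

/-- The open half-space `{w_N > 0}`. [folklore] -/
def Hp (N : ℕ) : Set (Fin M → ℝ) := {w | ∃ i : Fin M, (i : ℕ) = N ∧ 0 < w i}

/-- The open half-space `{w_N < 0}`. [folklore] -/
def Hm (N : ℕ) : Set (Fin M → ℝ) := {w | ∃ i : Fin M, (i : ℕ) = N ∧ w i < 0}

/-- The "upper hemisphere" piece `Z N ∪ {w_{N+1} > 0}`. [cite: HatcherAT2002, §3.1 p. 204] -/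
def Zp (N : ℕ) : Set (Fin M → ℝ) := Z N ∪ Hp (N + 1)

/-- The "lower hemisphere" piece `Z N ∪ {w_{N+1} < 0}`. [cite: HatcherAT2002, §3.1 p. 204] -/
def Zm (N : ℕ) : Set (Fin M → ℝ) := Z N ∪ Hm (N + 1)

/-- `Z N` is open. [folklore] -/
theorem isOpen_Z (N : ℕ) : IsOpen (Z N : Set (Fin M → ℝ)) := by
  have : (Z N : Set (Fin M → ℝ)) = ⋃ i : Fin M, ⋃ (_ : (i : ℕ) ≤ N), {w : Fin M → ℝ | w i ≠ 0} := by
    ext w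
    simp only [Z, mem_setOf_eq, mem_iUnion, exists_prop]
  rw [this]
  exact isOpen_iUnion fun i ↦ isOpen_iUnion fun _ ↦ isOpen_ne_fun (continuous_apply i) continuous_const

/-- `Hp N` is open. [folklore] -/
theorem isOpen_Hp (N : ℕ) : IsOpen (Hp N : Set (Fin M → ℝ)) := by
  have : (Hp N : Set (Fin M → ℝ)) = ⋃ i : Fin M, ⋃ (_ : (i : ℕ) = N), {w : Fin M → ℝ | 0 < w i} := by
    ext w
    simp only [Hp, mem_setOf_eq, mem_iUnion, exists_prop]
  rw [this]
  exact isOpen_iUnion fun i ↦ isOpen_iUnion fun _ ↦ isOpen_lt continuous_const (continuous_apply i)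

/-- `Hm N` is open. [folklore] -/
theorem isOpen_Hm (N : ℕ) : IsOpen (Hm N : Set (Fin M → ℝ)) := by
  have : (Hm N : Set (Fin M → ℝ)) = ⋃ i : Fin M, ⋃ (_ : (i : ℕ) = N), {w : Fin M → ℝ | w i < 0} := by
    ext w
    simp only [Hm, mem_setOf_eq, mem_iUnion, exists_prop]
  rw [this]
  exact isOpen_iUnion fun i ↦ isOpen_iUnion fun _ ↦ isOpen_lt (continuous_apply i) continuous_const

/-- `Zp N` is open. [folklore] -/
theorem isOpen_Zp (N : ℕ) : IsOpen (Zp N : Set (Fin M → ℝ)) := (isOpen_Z N).union (isOpen_Hp _)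

/-- `Zm N` is open. [folklore] -/
theorem isOpen_Zm (N : ℕ) : IsOpen (Zm N : Set (Fin M → ℝ)) := (isOpen_Z N).union (isOpen_Hm _)

/-- `Z N ⊆ Z (N + 1)`. [folklore] -/
theorem Z_mono (N : ℕ) : (Z N : Set (Fin M → ℝ)) ⊆ Z (N + 1) := fun _ ⟨i, hi, h⟩ ↦ ⟨i, by omega, h⟩

/-- **`Zp N ∩ Zm N = Z N`** (the two hemispheres meet in the equatorial band). [cite: HatcherAT2002, §3.1 p. 204] -/
theorem Zp_inter_Zm (N : ℕ) : (Zp N ∩ Zm N : Set (Fin M → ℝ)) = Z N := by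
  ext w
  constructor
  · rintro ⟨h₁ | ⟨i, hi, hpos⟩, h₂ | ⟨j, hj, hneg⟩⟩
    · exact h₁
    · exact h₁
    · exact h₂
    · exfalso
      have hij : i = j := Fin.ext (by omega)
      subst hij
      exact lt_asymm hpos hneg
  · exact fun h ↦ ⟨Or.inl h, Or.inl h⟩

/-- **`Zp N ∪ Zm N = Z (N + 1)`.** [cite: HatcherAT2002, §3.1 p. 204] -/
theorem Zp_union_Zm (N : ℕ) : (Zp N ∪ Zm N : Set (Fin M → ℝ)) = Z (N + 1) := by
  ext w
  constructor
  · rintro ((h | ⟨i, hi, hpos⟩) | (h | ⟨i, hi, hneg⟩))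
    · exact Z_mono N h
    · exact ⟨i, by omega, hpos.ne'⟩
    · exact Z_mono N h
    · exact ⟨i, by omega, hneg.ne⟩
  · rintro ⟨i, hi, hne⟩
    rcases Nat.lt_or_ge (i : ℕ) (N + 1) with hlt | hge
    · exact Or.inl (Or.inl ⟨i, by omega, hne⟩)
    · have hiN : (i : ℕ) = N + 1 := le_antisymm hi hge
      rcases lt_or_gt_of_ne hne with hneg | hpos
      · exact Or.inr (Or.inr ⟨i, hiN, hneg⟩)
      · exact Or.inl (Or.inr ⟨i, hiN, hpos⟩)

/-- **`Z 0 = Hp 0 ∪ Hm 0`.** [folklore] -/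
theorem Z_zero : (Z 0 : Set (Fin M → ℝ)) = Hp 0 ∪ Hm 0 := by
  ext w
  constructor
  · rintro ⟨i, hi, hne⟩
    rcases lt_or_gt_of_ne hne with hneg | hpos
    · exact Or.inr ⟨i, by omega, hneg⟩
    · exact Or.inl ⟨i, by omega, hpos⟩
  · rintro (⟨i, hi, hpos⟩ | ⟨i, hi, hneg⟩)
    · exact ⟨i, by omega, hpos.ne'⟩
    · exact ⟨i, by omega, hneg.ne⟩

/-- **`Hp N ∩ Hm N = ∅`.** [folklore] -/
theorem Hp_inter_Hm (N : ℕ) : (Hp N ∩ Hm N : Set (Fin M → ℝ)) = ∅ := by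
  ext w
  simp only [mem_inter_iff, mem_empty_iff_false, iff_false, not_and]
  rintro ⟨i, hi, hpos⟩ ⟨j, hj, hneg⟩
  have hij : i = j := Fin.ext (by omega)
  subst hij
  exact lt_asymm hpos hneg

/-- **`Z (M - 1) = ℝᴹ ∖ 0`** (`M ≥ 1`). [folklore] -/
theorem Z_pred_eq (hM : 0 < M) : (Z (M - 1) : Set (Fin M → ℝ)) = {0}ᶜ := by
  ext w
  simp only [Z, mem_setOf_eq, mem_compl_iff, mem_singleton_iff]
  constructor
  · rintro ⟨i, -, hne⟩ rfl
    exact hne rfl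
  · intro hw
    obtain ⟨i, hi⟩ := Function.ne_iff.1 hw
    exact ⟨i, by have := i.2; omega, hi⟩

/-- Coordinates of a point of a segment from `e • δᵢ₀`. [folklore] -/
theorem segment_apply (i₀ : Fin M) (c a b : ℝ) (y : Fin M → ℝ) (i : Fin M) :
    (a • (Pi.single i₀ c : Fin M → ℝ) + b • y) i = a * (if i = i₀ then c else 0) + b * y i := by
  simp only [Pi.add_apply, Pi.smul_apply, smul_eq_mul, Pi.single_apply]

/-- `a + b y > 0` for `a, b ≥ 0`, `a + b = 1`, `y > 0`. [folklore] -/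
theorem pos_of_convex_comb {a b y : ℝ} (ha : 0 ≤ a) (hb : 0 ≤ b) (hab : a + b = 1) (hy : 0 < y) :
    0 < a * 1 + b * y := by
  rcases eq_or_lt_of_le ha with rfl | ha'
  · rw [zero_add] at hab
    subst hab
    simpa using hy
  · have : 0 ≤ b * y := mul_nonneg hb hy.le
    linarith

/-- **`Zp N` is star-convex about `e_{N+1}`.** [cite: HatcherAT2002, §3.1 p. 204] -/
theorem starConvex_Zp (N : ℕ) (h : N + 1 < M) :
    StarConvex ℝ (Pi.single (⟨N + 1, h⟩ : Fin M) (1 : ℝ)) (Zp N) := by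
  intro y hy a b ha hb hab
  by_cases hb0 : b = 0
  · subst hb0
    rw [add_zero] at hab
    subst hab
    refine Or.inr ⟨⟨N + 1, h⟩, rfl, ?_⟩
    simp
  have hb' : 0 < b := lt_of_le_of_ne hb (Ne.symm hb0)
  rcases hy with ⟨i, hi, hne⟩ | ⟨i, hi, hpos⟩
  · refine Or.inl ⟨i, hi, ?_⟩
    have hii : i ≠ ⟨N + 1, h⟩ := fun heq ↦ by rw [heq] at hi; exact absurd hi (by simp)
    rw [segment_apply, if_neg hii, mul_zero, zero_add]
    exact mul_ne_zero hb0 hne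
  · refine Or.inr ⟨i, hi, ?_⟩
    have hii : i = ⟨N + 1, h⟩ := Fin.ext hi
    rw [segment_apply, if_pos hii]
    exact pos_of_convex_comb ha hb hab hpos

/-- **`Zm N` is star-convex about `-e_{N+1}`.** [cite: HatcherAT2002, §3.1 p. 204] -/
theorem starConvex_Zm (N : ℕ) (h : N + 1 < M) :
    StarConvex ℝ (Pi.single (⟨N + 1, h⟩ : Fin M) (-1 : ℝ)) (Zm N) := by
  intro y hy a b ha hb hab
  by_cases hb0 : b = 0
  · subst hb0
    rw [add_zero] at hab
    subst hab
    refine Or.inr ⟨⟨N + 1, h⟩, rfl, ?_⟩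
    simp
  have hb' : 0 < b := lt_of_le_of_ne hb (Ne.symm hb0)
  rcases hy with ⟨i, hi, hne⟩ | ⟨i, hi, hneg⟩
  · refine Or.inl ⟨i, hi, ?_⟩
    have hii : i ≠ ⟨N + 1, h⟩ := fun heq ↦ by rw [heq] at hi; exact absurd hi (by simp)
    rw [segment_apply, if_neg hii, mul_zero, zero_add]
    exact mul_ne_zero hb0 hne
  · refine Or.inr ⟨i, hi, ?_⟩
    have hii : i = ⟨N + 1, h⟩ := Fin.ext hi
    rw [segment_apply, if_pos hii]
    have := pos_of_convex_comb ha hb hab (neg_pos.2 hneg)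
    linarith

/-- **`Hp N` is star-convex about `e_N`** (indeed convex). [folklore] -/
theorem starConvex_Hp (N : ℕ) (h : N < M) : StarConvex ℝ (Pi.single (⟨N, h⟩ : Fin M) (1 : ℝ)) (Hp N) := by
  rintro y ⟨i, hi, hpos⟩ a b ha hb hab
  refine ⟨i, hi, ?_⟩
  rw [segment_apply, if_pos (Fin.ext hi)]
  exact pos_of_convex_comb ha hb hab hpos

/-- **`Hm N` is star-convex about `-e_N`** (indeed convex). [folklore] -/
theorem starConvex_Hm (N : ℕ) (h : N < M) : StarConvex ℝ (Pi.single (⟨N, h⟩ : Fin M) (-1 : ℝ)) (Hm N) := by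
  rintro y ⟨i, hi, hneg⟩ a b ha hb hab
  refine ⟨i, hi, ?_⟩
  rw [segment_apply, if_pos (Fin.ext hi)]
  have := pos_of_convex_comb ha hb hab (neg_pos.2 hneg)
  linarith

/-- `e_N ∈ Hp N`. [folklore] -/
theorem single_mem_Hp (N : ℕ) (h : N < M) : (Pi.single (⟨N, h⟩ : Fin M) (1 : ℝ)) ∈ Hp N :=
  ⟨⟨N, h⟩, rfl, by simp⟩

/-- `-e_N ∈ Hm N`. [folklore] -/
theorem single_mem_Hm (N : ℕ) (h : N < M) : (Pi.single (⟨N, h⟩ : Fin M) (-1 : ℝ)) ∈ Hm N :=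
  ⟨⟨N, h⟩, rfl, by simp⟩

/-- `e_{N+1} ∈ Zp N`. [folklore] -/
theorem single_mem_Zp (N : ℕ) (h : N + 1 < M) : (Pi.single (⟨N + 1, h⟩ : Fin M) (1 : ℝ)) ∈ Zp N :=
  Or.inr (single_mem_Hp (N + 1) h)

/-- `-e_{N+1} ∈ Zm N`. [folklore] -/
theorem single_mem_Zm (N : ℕ) (h : N + 1 < M) : (Pi.single (⟨N + 1, h⟩ : Fin M) (-1 : ℝ)) ∈ Zm N :=
  Or.inr (single_mem_Hm (N + 1) h)

end SphereSets

/-! ### The coordinate map of the affine chart of `ℙ V` and its pieces -/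

section Pieces

variable {V : Type} [NormedAddCommGroup V] [NormedSpace ℂ V] {ψ : StrongDual ℂ V} {u : V} (hu : ψ u = 1)

/-- The projection `P = 𝟙 - ψ ⊗ u` onto `ker ψ`, as a map into `ker ψ`. [folklore] -/
def projKer (hu : ψ u = 1) : V →L[ℂ] ↥(LinearMap.ker (ψ : V →ₗ[ℂ] ℂ)) :=
  (hyperplaneProj ψ u).codRestrict _ fun v ↦ by
    rw [LinearMap.mem_ker, ContinuousLinearMap.coe_coe]
    exact apply_hyperplaneProj hu v

/-- `projKer v = v - ψ v • u` as a vector. [folklore] -/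
@[simp]
theorem coe_projKer (v : V) : (projKer hu v : V) = v - ψ v • u := rfl

variable {Mdim : ℕ} (e : ↥(LinearMap.ker (ψ : V →ₗ[ℂ] ℂ)) ≃L[ℝ] (Fin Mdim → ℝ))

/-- **The real coordinate map of the affine chart**: `[v] ↦ e(P(v / ψ v)) ∈ ℝᴹ` (meaningful on
`U_ψ`; `P(v/ψ v) = v/ψ v - u`). [cite: HatcherAT2002, Ch. 0 p. 7] -/
def coordMap : ℙ ℂ V → (Fin Mdim → ℝ) := fun p ↦ e (projKer hu (affineRep (ψ : Module.Dual ℂ V) p))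

/-- The coordinate map is continuous on the affine chart. [folklore] -/
theorem continuousOn_coordMap : ContinuousOn (coordMap hu e) (chartDomain (ψ : Module.Dual ℂ V)) :=
  (e.continuous.comp (projKer hu).continuous).comp_continuousOn (continuousOn_affineRep _ ψ.continuous)

/-- **The piece of `ℙ V` cut out by `Zs ⊆ ℝᴹ`**: the points of `U_ψ` with coordinates in `Zs`. [folklore] -/
def pieceSet (Zs : Set (Fin Mdim → ℝ)) : Set (ℙ ℂ V) := chartDomain (ψ : Module.Dual ℂ V) ∩ coordMap hu e ⁻¹' Zs

/-- Pieces of open sets are open. [folklore] -/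
theorem isOpen_pieceSet {Zs : Set (Fin Mdim → ℝ)} (hZ : IsOpen Zs) : IsOpen (pieceSet hu e Zs) :=
  (continuousOn_coordMap hu e).isOpen_inter_preimage (isOpen_chartDomain _ ψ.continuous) hZ

/-- `pieceSet` commutes with intersections. [folklore] -/
theorem pieceSet_inter (Z₁ Z₂ : Set (Fin Mdim → ℝ)) :
    pieceSet hu e (Z₁ ∩ Z₂) = pieceSet hu e Z₁ ∩ pieceSet hu e Z₂ := by
  rw [pieceSet, pieceSet, pieceSet, preimage_inter, inter_inter_distrib_left]

/-- `pieceSet` commutes with unions. [folklore] -/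
theorem pieceSet_union (Z₁ Z₂ : Set (Fin Mdim → ℝ)) :
    pieceSet hu e (Z₁ ∪ Z₂) = pieceSet hu e Z₁ ∪ pieceSet hu e Z₂ := by
  rw [pieceSet, pieceSet, pieceSet, preimage_union, inter_union_distrib_left]

/-- `pieceSet ∅ = ∅`. [folklore] -/
theorem pieceSet_empty : pieceSet hu e (∅ : Set (Fin Mdim → ℝ)) = ∅ := by
  rw [pieceSet, preimage_empty, inter_empty]

/-- `pieceSet ℝᴹ = U_ψ`. [folklore] -/
theorem pieceSet_univ : pieceSet hu e (univ : Set (Fin Mdim → ℝ)) = chartDomain (ψ : Module.Dual ℂ V) := by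
  rw [pieceSet, preimage_univ, inter_univ]

/-- **`pieceSet (ℝᴹ ∖ 0) = U_ψ ∩ projChart P`**, the punctured affine chart. [cite: HatcherAT2002, Ch. 0 p. 7] -/
theorem pieceSet_compl_zero :
    pieceSet hu e ({0}ᶜ : Set (Fin Mdim → ℝ)) = chartDomain (ψ : Module.Dual ℂ V) ∩ projChart (hyperplaneProj ψ u) := by
  ext p
  constructor
  · rintro ⟨hp, hne⟩
    refine ⟨hp, (mem_projChart_iff_affineRep_ne u hp).2 fun h0 ↦ hne ?_⟩
    change e (projKer hu (affineRep (ψ : Module.Dual ℂ V) p)) = 0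
    have h1 := apply_affineRep (ψ : Module.Dual ℂ V) hp
    rw [ContinuousLinearMap.coe_coe] at h1
    have : projKer hu (affineRep (ψ : Module.Dual ℂ V) p) = 0 := Subtype.ext (by
      rw [coe_projKer, h1, one_smul, h0]; rfl)
    rw [this, map_zero]
  · rintro ⟨hp, hq⟩
    refine ⟨hp, fun h0 ↦ (mem_projChart_iff_affineRep_ne u hp).1 hq ?_⟩
    have h1 := apply_affineRep (ψ : Module.Dual ℂ V) hp
    rw [ContinuousLinearMap.coe_coe] at h1
    have h2 : e (projKer hu (affineRep (ψ : Module.Dual ℂ V) p)) = 0 := h0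
    rw [e.map_eq_zero_iff] at h2
    have h3 := congrArg Subtype.val h2
    rwa [coe_projKer, h1, one_smul] at h3

/-- **`{ψ = 1} ≃ₜ ker ψ`** by `a ↦ P a = a - u`, inverse `w ↦ w + u`. [folklore] -/
def levelSetHomeomorphKer : ↥{v : V | ψ v = 1} ≃ₜ ↥(LinearMap.ker (ψ : V →ₗ[ℂ] ℂ)) where
  toFun a := projKer hu a.1
  invFun w := ⟨(w : V) + u, apply_add_eq_one hu w⟩
  left_inv a := Subtype.ext (by
    change ((projKer hu a.1 : V)) + u = a.1
    rw [coe_projKer, show ψ a.1 = 1 from a.2, one_smul, sub_add_cancel])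
  right_inv w := Subtype.ext (by
    change ((projKer hu ((w : V) + u)) : V) = w
    rw [coe_projKer, apply_add_eq_one hu w, one_smul, add_sub_cancel_right])
  continuous_toFun := (projKer hu).continuous.comp continuous_subtype_val
  continuous_invFun := (continuous_subtype_val.add continuous_const).subtype_mk _

/-- **The real coordinates of the affine chart, `U_ψ ≃ₜ ℝᴹ`.** [cite: HatcherAT2002, Ch. 0 p. 7] -/
def chartCoordHomeomorph : ↥(chartDomain (ψ : Module.Dual ℂ V)) ≃ₜ (Fin Mdim → ℝ) :=
  (affineChartHomeomorph ψ).trans ((levelSetHomeomorphKer hu).trans e.toHomeomorph)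

/-- The coordinate homeomorphism is the coordinate map. [folklore] -/
@[simp]
theorem chartCoordHomeomorph_apply (p : ↥(chartDomain (ψ : Module.Dual ℂ V))) :
    chartCoordHomeomorph hu e p = coordMap hu e p.1 := rfl

/-- **`pieceSet Zs ≃ₜ Zs`.** [folklore] -/
def pieceHomeomorph (Zs : Set (Fin Mdim → ℝ)) : ↥(pieceSet hu e Zs) ≃ₜ ↥Zs where
  toFun x := ⟨chartCoordHomeomorph hu e ⟨x.1, x.2.1⟩, x.2.2⟩
  invFun z := ⟨((chartCoordHomeomorph hu e).symm z.1).1,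
    ((chartCoordHomeomorph hu e).symm z.1).2, by
      change coordMap hu e ((chartCoordHomeomorph hu e).symm z.1).1 ∈ Zs
      rw [← chartCoordHomeomorph_apply, Homeomorph.apply_symm_apply]
      exact z.2⟩
  left_inv x := by
    apply Subtype.ext
    change ((chartCoordHomeomorph hu e).symm (chartCoordHomeomorph hu e ⟨x.1, x.2.1⟩)).1 = x.1
    rw [Homeomorph.symm_apply_apply]
  right_inv z := by
    apply Subtype.ext
    change chartCoordHomeomorph hu e ⟨((chartCoordHomeomorph hu e).symm z.1).1, _⟩ = z.1
    rw [Subtype.coe_eta, Homeomorph.apply_symm_apply]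
  continuous_toFun := ((chartCoordHomeomorph hu e).continuous.comp
    (continuous_inclusion inter_subset_left)).subtype_mk _
  continuous_invFun := (continuous_subtype_val.comp
    ((chartCoordHomeomorph hu e).symm.continuous.comp continuous_subtype_val)).subtype_mk _

/-- **Pieces of star-convex sets are contractible.** [cite: HatcherAT2002, Ch. 0 p. 7] -/
theorem contractibleSpace_pieceSet {Zs : Set (Fin Mdim → ℝ)} {c : Fin Mdim → ℝ} (hZ : StarConvex ℝ c Zs)
    (hc : c ∈ Zs) : ContractibleSpace ↥(pieceSet hu e Zs) :=
  haveI : ContractibleSpace ↥Zs := hZ.contractibleSpace ⟨c, hc⟩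
  (pieceHomeomorph hu e Zs).contractibleSpace

end Pieces

end Literature.AlgebraicTopology.CharacteristicClasses
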